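import Mathlib.Analysis.SpecialFunctions.Complex.Circle
import Summits.Parity.GeneralizedHardyLittlewood.Theorems.GreenTaoLevelTwoMNTwoBohrGauge

/-!
# Route `GreenTaoLevelTwo`, crux `MNTwo` (stmt-Parity-21276), line `birth`, stub `stub_mnVertical`:
# glue between the printed form of Prop. 19 (as consumed by §8) and the abstract-gauge vocabulary

Glue for blocks V4–V6 of the `stub_mnVertical` census (B. Green, T. Tao, *Quadratic uniformity of
the Möbius function*, Ann. Inst. Fourier 58 (2008) = arXiv:math/0606087, §8 Prop. 19 / §§9–12).
Block V3 (`…MNTwoSectionEight.sum_moebius_localQuadratic_dyadic_le`, hypothesis `hP`) consumes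
Proposition 19 in the following printed vocabulary: a REAL phase `φ : ℤ → ℝ` whose alternating sums
over `3`-cubes inside `B_α(n₀,100ρ)` (cubes parametrised by `e₁, e₂, e₃ ∈ {0,1} ⊂ ℕ`, membership as
the Bohr predicate) are INTEGERS, a weight `ψ` with the Lipschitz bound in "`t`-form", and the
character `𝐞(−φ(n))`.  Blocks V4–V6 (`…MNTwoLocalQuadratic`, `…MNTwoMajorArcThreeTerm`,
`…MNTwoMajorArcLocal`, `…MNTwoAlmostLinearThreeTermSum`) work with an `ℝ/ℤ`-valued phase whose cube
sums VANISH, the eight memberships listed with `a, b, c`, the gauge `ν` of `…MNTwoBohrGauge`, and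
`AddCircle.toCircle (−φ n)`.  This def-free file converts the former into the latter:

* `toCircle_coe_eq_fourierChar` — `toCircle ((x : ℝ) : ℝ/ℤ) = 𝐞 x`, hence the two sums agree;
* `cube_vanish_of_integral` — integral real cube sums ⇒ vanishing cube sums in `ℝ/ℤ` for
  `φ' = (↑) ∘ φ`, with the gauge-ball memberships of `…MNTwoLocalQuadratic`;
* `shift_bound_of_lipschitz` — the `t`-form Lipschitz hypothesis gives
  `|ψ(n+h₁+h₂) − ψ(n)| ≤ ν(h₁) + ν(h₂)`.

References: [GreenTao2008QuadraticMobius] arXiv:math/0606087 §8 (Prop. 19), §9, §12.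
-/

noncomputable section

open Finset Real
open scoped FourierTransform

namespace Summit.Parity.GeneralizedHardyLittlewood.GreenTaoLevelTwoMNTwoPropNineteenGlue

open Summit.Parity.GeneralizedHardyLittlewood.GreenTaoLevelTwoMNTwoBohrGauge
  (bohrGauge_lt_iff bohrGauge_add_le bddAbove_range_norm iSup_norm_nonneg)

variable {k : ℕ}

/-- `toCircle ((x : ℝ) : ℝ/ℤ) = 𝐞 x`. [folklore] -/
theorem toCircle_coe_eq_fourierChar (x : ℝ) :
    (AddCircle.toCircle ((x : ℝ) : UnitAddCircle) : ℂ) = (𝐞 x : ℂ) := by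
  rw [AddCircle.toCircle_apply_mk, Real.fourierChar_apply']
  simp

/-- The Möbius sum against `ψ e(−φ)` in the two vocabularies. [folklore] -/
theorem sum_toCircle_eq_sum_fourierChar (ψ φ : ℤ → ℝ) (S : Finset ℕ) (c : ℕ → ℂ) :
    ∑ n ∈ S, c n * ((ψ n : ℝ) : ℂ) *
        ((AddCircle.toCircle (-(((φ n : ℝ)) : UnitAddCircle)) : Circle) : ℂ) =
      ∑ n ∈ S, c n * ((ψ n : ℝ) : ℂ) * (𝐞 (-(φ n)) : ℂ) := by
  refine Finset.sum_congr rfl fun n _ => ?_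
  rw [← AddCircle.coe_neg, toCircle_coe_eq_fourierChar]

/-- **Integral cube sums ⇒ vanishing cube sums in `ℝ/ℤ`.**  If the real phase `φ` has integral
alternating sums over every `3`-cube whose `8` vertices satisfy the Bohr predicate at radius `R`
around `n₀` (cubes parametrised by `e₁,e₂,e₃ ≤ 1` in `ℕ`, as in `…MNTwoSectionEight`), then
`φ' = (↑) ∘ φ : ℤ → ℝ/ℤ` satisfies the eight-membership hypothesis `hφ` of `…MNTwoLocalQuadratic`
for the gauge `ν(n) = ⨆ᵢ‖nαᵢ‖ + |n|/N`. [cite: GreenTao2008QuadraticMobius, Def. 3 and §9] -/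
theorem cube_vanish_of_integral (α : Fin k → ℝ) (N : ℕ) (n₀ : ℤ) (R : ℝ) (φ : ℤ → ℝ)
    (hφ : ∀ n h₁ h₂ h₃ : ℤ,
      (∀ e₁ e₂ e₃ : ℕ, e₁ ≤ 1 → e₂ ≤ 1 → e₃ ≤ 1 →
        (∀ i, ‖((((n + e₁ * h₁ + e₂ * h₂ + e₃ * h₃ - n₀ : ℤ) : ℝ) * α i : ℝ) : AddCircle (1 : ℝ))‖ +
            |((n + e₁ * h₁ + e₂ * h₂ + e₃ * h₃ - n₀ : ℤ) : ℝ)| / N < R) ∧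
          |((n + e₁ * h₁ + e₂ * h₂ + e₃ * h₃ - n₀ : ℤ) : ℝ)| / N < R) →
      ∃ z : ℤ, φ (n + h₁ + h₂ + h₃) - φ (n + h₁ + h₂) - φ (n + h₁ + h₃) - φ (n + h₂ + h₃)
        + φ (n + h₁) + φ (n + h₂) + φ (n + h₃) - φ n = z) :
    ∀ n a b c : ℤ,
      (⨆ i : Fin k, ‖((((n - n₀ : ℤ) : ℝ) * α i : ℝ) : AddCircle (1 : ℝ))‖) + |((n - n₀ : ℤ) : ℝ)| / N < R →
      (⨆ i : Fin k, ‖((((n + a - n₀ : ℤ) : ℝ) * α i : ℝ) : AddCircle (1 : ℝ))‖) +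
        |((n + a - n₀ : ℤ) : ℝ)| / N < R →
      (⨆ i : Fin k, ‖((((n + b - n₀ : ℤ) : ℝ) * α i : ℝ) : AddCircle (1 : ℝ))‖) +
        |((n + b - n₀ : ℤ) : ℝ)| / N < R →
      (⨆ i : Fin k, ‖((((n + c - n₀ : ℤ) : ℝ) * α i : ℝ) : AddCircle (1 : ℝ))‖) +
        |((n + c - n₀ : ℤ) : ℝ)| / N < R →
      (⨆ i : Fin k, ‖((((n + a + b - n₀ : ℤ) : ℝ) * α i : ℝ) : AddCircle (1 : ℝ))‖) +
        |((n + a + b - n₀ : ℤ) : ℝ)| / N < R →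
      (⨆ i : Fin k, ‖((((n + a + c - n₀ : ℤ) : ℝ) * α i : ℝ) : AddCircle (1 : ℝ))‖) +
        |((n + a + c - n₀ : ℤ) : ℝ)| / N < R →
      (⨆ i : Fin k, ‖((((n + b + c - n₀ : ℤ) : ℝ) * α i : ℝ) : AddCircle (1 : ℝ))‖) +
        |((n + b + c - n₀ : ℤ) : ℝ)| / N < R →
      (⨆ i : Fin k, ‖((((n + a + b + c - n₀ : ℤ) : ℝ) * α i : ℝ) : AddCircle (1 : ℝ))‖) +
        |((n + a + b + c - n₀ : ℤ) : ℝ)| / N < R →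
      (((φ (n + a + b + c) : ℝ) : UnitAddCircle) - ((φ (n + a + b) : ℝ) : UnitAddCircle)
        - ((φ (n + a + c) : ℝ) : UnitAddCircle) - ((φ (n + b + c) : ℝ) : UnitAddCircle)
        + ((φ (n + a) : ℝ) : UnitAddCircle) + ((φ (n + b) : ℝ) : UnitAddCircle)
        + ((φ (n + c) : ℝ) : UnitAddCircle) - ((φ n : ℝ) : UnitAddCircle)) = 0 := by
  intro n a b c h0 ha hb hc hab hac hbc habc
  -- all eight vertices satisfy the Bohr predicate
  have hcube : ∀ e₁ e₂ e₃ : ℕ, e₁ ≤ 1 → e₂ ≤ 1 → e₃ ≤ 1 →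
      (∀ i, ‖((((n + e₁ * a + e₂ * b + e₃ * c - n₀ : ℤ) : ℝ) * α i : ℝ) : AddCircle (1 : ℝ))‖ +
          |((n + e₁ * a + e₂ * b + e₃ * c - n₀ : ℤ) : ℝ)| / N < R) ∧
        |((n + e₁ * a + e₂ * b + e₃ * c - n₀ : ℤ) : ℝ)| / N < R := by
    have key : ∀ m : ℤ,
        (⨆ i : Fin k, ‖((((m : ℤ) : ℝ) * α i : ℝ) : AddCircle (1 : ℝ))‖) + |((m : ℤ) : ℝ)| / N < R →
        (∀ i, ‖((((m : ℤ) : ℝ) * α i : ℝ) : AddCircle (1 : ℝ))‖ + |((m : ℤ) : ℝ)| / N < R) ∧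
          |((m : ℤ) : ℝ)| / N < R := fun m hm => (bohrGauge_lt_iff α N m R).1 hm
    intro e₁ e₂ e₃ he₁ he₂ he₃
    interval_cases e₁ <;> interval_cases e₂ <;> interval_cases e₃ <;>
      simp only [Nat.cast_zero, Nat.cast_one, zero_mul, one_mul, add_zero] <;>
      first
      | exact key _ h0 | exact key _ ha | exact key _ hb | exact key _ hc
      | exact key _ hab | exact key _ hac | exact key _ hbc | exact key _ habc
  obtain ⟨z, hz⟩ := hφ n a b c hcube
  rw [← AddCircle.coe_sub, ← AddCircle.coe_sub, ← AddCircle.coe_sub, ← AddCircle.coe_add,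
    ← AddCircle.coe_add, ← AddCircle.coe_add, ← AddCircle.coe_sub, hz, AddCircle.coe_eq_zero_iff]
  exact ⟨z, by simp⟩

/-- **The `t`-form Lipschitz hypothesis gives the shift bound** used by the three-term Prop. 15:
`|ψ(n+h₁+h₂) − ψ(n)| ≤ ν(h₁) + ν(h₂)` for the gauge `ν(h) = ⨆ᵢ‖hαᵢ‖ + |h|/N`.
[cite: GreenTao2008QuadraticMobius, §12 (the Lipschitz bound (lip) on Bohr sets)] -/
theorem shift_bound_of_lipschitz (α : Fin k → ℝ) (N : ℕ) (ψ : ℤ → ℝ)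
    (hlip : ∀ (n n' : ℤ) (t : ℝ), 0 ≤ t →
      (∀ i, ‖((((n - n' : ℤ) : ℝ) * α i : ℝ) : AddCircle (1 : ℝ))‖ ≤ t) →
        |ψ n - ψ n'| ≤ t + |((n - n' : ℤ) : ℝ)| / N)
    (n h₁ h₂ : ℤ) :
    |ψ (n + h₁ + h₂) - ψ n| ≤
      ((⨆ i : Fin k, ‖(((h₁ : ℝ) * α i : ℝ) : AddCircle (1 : ℝ))‖) + |(h₁ : ℝ)| / N) +
        ((⨆ i : Fin k, ‖(((h₂ : ℝ) * α i : ℝ) : AddCircle (1 : ℝ))‖) + |(h₂ : ℝ)| / N) := by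
  have hsub : (n + h₁ + h₂ - n : ℤ) = h₁ + h₂ := by ring
  have h1 := hlip (n + h₁ + h₂) n
    (⨆ i : Fin k, ‖((((h₁ + h₂ : ℤ) : ℝ) * α i : ℝ) : AddCircle (1 : ℝ))‖) (iSup_norm_nonneg α _)
    (fun i => by rw [hsub]; exact le_ciSup (bddAbove_range_norm α (h₁ + h₂)) i)
  rw [hsub] at h1
  exact h1.trans (bohrGauge_add_le α N h₁ h₂)

end Summit.Parity.GeneralizedHardyLittlewood.GreenTaoLevelTwoMNTwoPropNineteenGlue
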